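import Summits.QuantumAdvantage.QuantumAdvantage.Theorems.AvgFaceBeyondPrior.Negative.AvgFaceBeyondPriorNecessary
import Literature.Computability.Complexity.BPPTruthTableClosure
import Literature.Computability.Complexity.TM2PassThrough

/-!
# Negative-side lemmas for the crux `ArithStatLadder.AvgFaceBeyondPrior` (stmt-QuantumAdvantage-2427):
# the refutation criterion (heuristic transfer with a finite patch)

Standing disprover's work file `Cruxes/AvgFaceBeyondPrior/Disproof.lean`, cdisprove gen 2 (2026-08-16).
Nothing here asserts a Theses decl positively: every conclusion is `¬ AvgFaceBeyondPrior`.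

The crux is `(IQ3, U) ∉ Heur_{1/3}BPP`. The landed `mem_HeurDeltaBPP_of_mem_BPP` (companion file
`AvgFaceBeyondPriorNecessary.lean`) is the ZERO-disagreement case: `IQ3 ∈ BPP ⇒ ¬ crux`. This file proves
the general **refutation criterion** every concrete attack on the crux has to meet, and nothing more:

* `mem_HeurDeltaBPP_of_approx_mem_BPP` — the transfer at ANY failure level `δ ≥ 0`: a `BPP` language
  within Hamming density `δ` of `IQ3` on every block `n > N` puts `(IQ3, U)` in `Heur_δBPP`;
  `mem_HeurDeltaBPP_of_density` — its constant-predictor instance (`U_n(3 ∣ h) ≤ δ` for `n > N` ⇒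
  `(IQ3,U) ∈ Heur_δBPP`: the δ-face is false above `limsup U_n(3 ∣ h)`, i.e. above `1/2` by
  Davenport–Heilbronn, above `0.44` by Cohen–Lenstra).
* `not_avgFace_of_approx_mem_BPP` — if some `K ∈ BPP` disagrees with `IQ3` on at most a THIRD of the
  dyadic block of n-bit fundamental discriminants at every level `n > N`, the crux is false. Proof: patch
  `K` below length `N` by the truth table of `IQ3` (still `BPP` by the tree's
  `mem_BPP_of_eqOn_le`, Book–Vollmer–Wagner), amplify to coin error `≤ 1/8`, truncate, lift to `(x, 1ⁿ)`
  (`paramLift`); the bad set (coin error `≥ 1/4`) lies inside the disagreement set, whose `Uₙ`-mass is the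
  counting ratio `≤ 1/3` (`ens_prob_eq`), and is empty at the patched levels and at the `pure []` levels.
* `not_avgFace_of_eventually_agree` — the same with the disagreement filter written over `d ∈ 𝒟ₙ` and
  `3 ∣ h(−d)`, eventually in `n` (the form a statistic-based attack produces).
* `not_avgFace_of_mirrorAgreement` — the `(1/6 + ε)`-form: VERBATIM the statement of stub
  `stub_heurTransfer` of the picked line `Lines/mirror_unit_signature.lean` (its `MirrorAgreement T`
  unfolded; `fundBlock` there is an alias of this namespace's `fundBlock`), so that stub closes by
  `fun T h hB => not_avgFace_of_mirrorAgreement T h hB` (wiring checked by the disprover against a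
  literal copy of `MirrorAgreement`, Disproof.lean v5 §6).

So the crux is EQUIVALENTLY attacked by exhibiting a `BPP` language within Hamming-density `1/3` of
`IQ3` on all late blocks; the disprover's numerics (kit j014529: residue classes, Kronecker symbols of `−d`
and of the mirror discriminant, `ω(d)`, continued-fraction data of `√d₀`) find no cheap statistic above
the constant predictor's `≈ 0.58`, against the `2/3` this criterion needs.
-/

namespace Summit.QuantumAdvantage.QuantumAdvantage.Theorems.AvgFaceBeyondPrior.Negative

open _root_.Computability
open Literature.Computability.Complexity Literature.Computability.MetaComplexity
open Literature.NumberTheory.QuadraticFields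
open Summit.QuantumAdvantage.QuantumAdvantage.Theses.ArithStatLadder
open scoped Classical
open Filter Finset

/-! ## Counting helpers -/

/-- An n-bit number has an `n`-digit binary code: `d ∈ 𝒟ₙ ⇒ |bin d| = n`. [folklore] -/
theorem length_encodeNat_of_mem_fundBlock {n d : ℕ} (hd : d ∈ fundBlock n) : (encodeNat d).length = n := by
  have hI := (mem_Ico.1 (mem_filter.1 hd).1)
  rw [TM2Pass.length_encodeNat_eq_size]
  have h1 : d.size ≤ n := Nat.size_le.2 hI.2
  have h2 : n - 1 < d.size := Nat.lt_size.2 hI.1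
  have h3 : 1 ≤ n := by
    by_contra h0
    push Not at h0
    interval_cases n
    simp at hI
    omega
  omega

/-- **Counting bound for `Uₙ`-probabilities** (instance-agnostic in the counting predicate `P`): if
every block point whose code lies in `E` satisfies `P`, and at most a `δ`-fraction of the block satisfies
`P`, then `Uₙ(E) ≤ δ`. [folklore] -/
theorem ens_prob_le_of_card {n : ℕ} (hne : (fundBlock n).Nonempty) {E : Set (List Bool)}
    {P : ℕ → Prop} {inst : DecidablePred P} {δ : ℝ}
    (hP : ∀ d ∈ fundBlock n, encodeNat d ∈ E → P d)
    (hc : (((fundBlock n).filter P).card : ℝ) ≤ δ * (fundBlock n).card) :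
    ens.prob n E ≤ δ := by
  rw [ens_prob_eq hne]
  have hcard : (0:ℝ) < (fundBlock n).card := by exact_mod_cast hne.card_pos
  rw [div_le_iff₀ hcard]
  have hsub : ((fundBlock n).filter fun d => encodeNat d ∈ E) ⊆ (fundBlock n).filter P := fun d hd =>
    mem_filter.2 ⟨(mem_filter.1 hd).1, hP d (mem_filter.1 hd).1 (mem_filter.1 hd).2⟩
  have h3 : (((fundBlock n).filter fun d => encodeNat d ∈ E).card : ℝ) ≤ ((fundBlock n).filter P).card := by
    exact_mod_cast card_le_card hsub
  linarith

/-! ## The refutation criterion -/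

/-- **Heuristic transfer with a finite patch, at any failure level `δ ≥ 0`.** If a `BPP` language `K`
disagrees with `IQ3` on at most a `δ`-fraction of the block `𝒟ₙ` of n-bit fundamental discriminants at
every level `n > N`, then `(IQ3, U) ∈ Heur_δBPP`. (Patch `K` below length `N` by the truth table of
`IQ3`, amplify to coin error `1/8`, truncate, `paramLift`; the bad set lies inside the disagreement set,
which is empty at the patched and at the `pure []` levels.) The counting hypothesis may carry any
`DecidablePred` instance. [cite: BogdanovTrevisan2006, §2.3] -/
theorem mem_HeurDeltaBPP_of_approx_mem_BPP {K : Set (List Bool)} (hK : K ∈ BPP) (N : ℕ) {δ : ℝ}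
    (hδ : 0 ≤ δ) {inst : DecidablePred fun d : ℕ => ¬ (d ∈ iq3Set ↔ encodeNat d ∈ K)}
    (hagree : ∀ n, N < n →
      (((fundBlock n).filter fun d : ℕ => ¬ (d ∈ iq3Set ↔ encodeNat d ∈ K)).card : ℝ)
        ≤ δ * (fundBlock n).card) :
    Q ∈ HeurDeltaBPP (fun _ => δ) := by
  -- the finite patch: `K` corrected by the truth table of `IQ3` on inputs of length `≤ N`
  set L : Set (List Bool) := {x | if x.length ≤ N then x ∈ iq3Lang else x ∈ K} with hLdef
  have hLle : ∀ x : List Bool, x.length ≤ N → (x ∈ L ↔ x ∈ iq3Lang) := fun x hx => by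
    simp [hLdef, hx]
  have hLlt : ∀ x : List Bool, N < x.length → (x ∈ L ↔ x ∈ K) := fun x hx => by
    simp [hLdef, Nat.not_le.2 hx]
  -- still `BPP`: `BPP` is invariant under finite variations (Book–Vollmer–Wagner)
  have hL : L ∈ BPP := mem_BPP_of_eqOn_le (L := L) hK (N + 1) fun x hx => hLlt x (by omega)
  obtain ⟨A, hA, hq, hcorrect⟩ := exists_randAlg_error_le_of_mem_BPP_holds hL (1 / 8) (by norm_num)
  have hB : (A.truncate id).IsPolyTime id encodeBool :=
    hA.truncate polyTimeComputable_boolPair_take_holds hq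
  have hobl : ∀ x r, (A.truncate id).run x r =
      (A.truncate id).run x (r.take ((A.truncate id).coinLen x.length)) :=
    fun x r => (A.truncate_run_take id x r).symm
  refine ⟨paramLift (A.truncate id), isPolyTime_paramLift hB, fun n => ?_⟩
  change ens.prob n {x | (1:ℝ) / 4 ≤ (paramLift (A.truncate id)).pr paramEnc (x, n)
      {b | b ≠ iq3Lang.boolIndicator x}} ≤ δ
  -- the bad set lies inside the disagreement set of the patched language with `IQ3`
  have hbad : ∀ x, (1:ℝ) / 4 ≤ (paramLift (A.truncate id)).pr paramEnc (x, n)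
      {b | b ≠ iq3Lang.boolIndicator x} → ¬ (x ∈ L ↔ x ∈ iq3Lang) := by
    intro x hx hiff
    have hind : L.boolIndicator x = iq3Lang.boolIndicator x := by
      by_cases hxL : x ∈ L
      · rw [(Set.mem_iff_boolIndicator _ _).1 hxL, (Set.mem_iff_boolIndicator _ _).1 (hiff.1 hxL)]
      · rw [(Set.notMem_iff_boolIndicator _ _).1 hxL,
          (Set.notMem_iff_boolIndicator _ _).1 fun h => hxL (hiff.2 h)]
    rw [← hind, pr_paramLift (A.truncate id) hq hobl, RandAlg.pr_truncate,
      RandAlg.pr_ne_eq_one_sub] at hx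
    have := hcorrect x
    linarith
  by_cases hne : (fundBlock n).Nonempty
  · by_cases hnN : n ≤ N
    · -- patched level: no disagreement on the block
      refine ens_prob_le_of_card hne (P := fun _ => False) (inst := inferInstance)
        (fun d hd hmem => hbad _ hmem
          (hLle _ (by rw [length_encodeNat_of_mem_fundBlock hd]; exact hnN))) ?_
      simp only [filter_false, card_empty, Nat.cast_zero]
      positivity
    · -- late level: count the disagreements
      push Not at hnN
      refine ens_prob_le_of_card hne ?_ (hagree n hnN)
      intro d hd hmem hiff
      refine hbad _ hmem ?_
      rw [hLlt _ (by rw [length_encodeNat_of_mem_fundBlock hd]; exact hnN), encodeNat_mem_iq3Lang]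
      exact hiff.symm
  · rw [ens_prob_of_not_nonempty hne]
    split_ifs with hmem
    · exact absurd (hLle [] (by simp)) (hbad _ hmem)
    · exact hδ

/-- **Refutation criterion for the crux** (`δ = 1/3`, counting form): a `BPP` language within Hamming
density `1/3` of `IQ3` on every block `𝒟ₙ`, `n > N`, refutes `AvgFaceBeyondPrior`. [cite: BogdanovTrevisan2006, §2.3] -/
theorem not_avgFace_of_approx_mem_BPP {K : Set (List Bool)} (hK : K ∈ BPP) (N : ℕ)
    {inst : DecidablePred fun d : ℕ => ¬ (d ∈ iq3Set ↔ encodeNat d ∈ K)}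
    (hagree : ∀ n, N < n →
      3 * ((fundBlock n).filter fun d : ℕ => ¬ (d ∈ iq3Set ↔ encodeNat d ∈ K)).card ≤ (fundBlock n).card) :
    ¬ AvgFaceBeyondPrior := by
  intro hcrux
  refine (avgFace_iff_Q.1 hcrux) (mem_HeurDeltaBPP_of_approx_mem_BPP hK N (by norm_num) (inst := inst)
    fun n hn => ?_)
  have h := hagree n hn
  have h' : (3:ℝ) * ((fundBlock n).filter fun d : ℕ => ¬ (d ∈ iq3Set ↔ encodeNat d ∈ K)).card
      ≤ (fundBlock n).card := by exact_mod_cast h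
  linarith

/-- A `BPP` (indeed `P`) spelling of the EMPTY language (the short part below length `0`), so that the
constant predictor `3 ∤ h` is an instance of the criterion. [folklore] -/
theorem emptyPart_mem_BPP :
    ({x | x ∈ (Set.univ : Set (List Bool)) ∧ x.length < 0} : Language Bool) ∈ BPP :=
  P_subset_BPP_holds (shortPart_mem_P _ 0)

/-- **The constant predictor as an instance: density form of the transfer.** If at every level `n > N`
at most a `δ`-fraction of the n-bit fundamental `−d` have `3 ∣ h(−d)`, then `(IQ3, U) ∈ Heur_δBPP`
(the constant answer `3 ∤ h`, patched below `N`). So the `δ`-face of the crux is FALSE at every `δ`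
above `limsup_n U_n(3 ∣ h)` — by Davenport–Heilbronn's first moment at most `1/2`, by Cohen–Lenstra
`0.43987`; the crux sits at `δ = 1/3`. [cite: CohenLenstra1984, §9 (C2)] -/
theorem mem_HeurDeltaBPP_of_density (N : ℕ) {δ : ℝ} (hδ : 0 ≤ δ)
    {inst : DecidablePred fun d : ℕ => 3 ∣ BinaryQuadraticForm.classNumber (-(d:ℤ))}
    (h : ∀ n, N < n →
      (((fundBlock n).filter fun d : ℕ => 3 ∣ BinaryQuadraticForm.classNumber (-(d:ℤ))).card : ℝ)
        ≤ δ * (fundBlock n).card) :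
    Q ∈ HeurDeltaBPP (fun _ => δ) := by
  refine mem_HeurDeltaBPP_of_approx_mem_BPP
    (K := ({x | x ∈ (Set.univ : Set (List Bool)) ∧ x.length < 0} : Language Bool))
    emptyPart_mem_BPP N hδ (inst := inferInstance) fun n hn => le_trans ?_ (h n hn)
  exact_mod_cast card_le_card fun d hd => by
    rw [mem_filter] at hd ⊢
    refine ⟨hd.1, ?_⟩
    have hK : encodeNat d ∉ ({x | x ∈ (Set.univ : Set (List Bool)) ∧ x.length < 0} : Language Bool) :=
      fun hx => Nat.not_lt_zero _ hx.2
    have hmem : d ∈ iq3Set := by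
      by_contra hno
      exact hd.2 ⟨fun h1 => absurd h1 hno, fun h2 => absurd h2 hK⟩
    exact hmem.2

/-- **Corollary (`δ = 1/3`): if from some level on at most a third of the n-bit fundamental `−d` have
`3 ∣ h(−d)`, the crux fails** — the contrapositive companion of the landed necessity lemma
`avgFace_imp_exists_level_ge` (crux ⇒ density `> 1/3` beyond every `N`), now an instance of the transfer.
[cite: CohenLenstra1984, §9 (C2)] -/
theorem not_avgFace_of_density_le_third (N : ℕ)
    {inst : DecidablePred fun d : ℕ => 3 ∣ BinaryQuadraticForm.classNumber (-(d:ℤ))}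
    (h : ∀ n, N < n →
      3 * ((fundBlock n).filter fun d : ℕ => 3 ∣ BinaryQuadraticForm.classNumber (-(d:ℤ))).card
        ≤ (fundBlock n).card) :
    ¬ AvgFaceBeyondPrior := by
  intro hcrux
  refine (avgFace_iff_Q.1 hcrux) (mem_HeurDeltaBPP_of_density N (by norm_num) (inst := inst) fun n hn => ?_)
  have h' : (3:ℝ) * ((fundBlock n).filter fun d : ℕ => 3 ∣ BinaryQuadraticForm.classNumber (-(d:ℤ))).card
      ≤ (fundBlock n).card := by exact_mod_cast h n hn
  linarith

/-- **Refutation criterion, arithmetic form.** If `bin T ∈ BPP` for a set `T ⊆ ℕ` that, eventually in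
`n`, disagrees with `3 ∣ h(−d)` on at most a third of the n-bit fundamental discriminants `−d`, the crux
fails. This is the exact target of every statistic-based attack (a classical predictor of `3 ∣ h(−d)`
right on `≥ 2/3` of every late block). [cite: BogdanovTrevisan2006, §2.3] -/
theorem not_avgFace_of_eventually_agree {T : Set ℕ} (hT : encodingNatBool.toLanguage T ∈ BPP)
    {inst : DecidablePred fun d : ℕ => ¬ (3 ∣ BinaryQuadraticForm.classNumber (-(d:ℤ)) ↔ d ∈ T)}
    (h : ∀ᶠ n : ℕ in atTop,
      3 * ((fundBlock n).filter fun d : ℕ =>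
        ¬ (3 ∣ BinaryQuadraticForm.classNumber (-(d:ℤ)) ↔ d ∈ T)).card ≤ (fundBlock n).card) :
    ¬ AvgFaceBeyondPrior := by
  obtain ⟨N, hN⟩ := eventually_atTop.1 h
  refine not_avgFace_of_approx_mem_BPP (K := encodingNatBool.toLanguage T) hT N
    (inst := inferInstance) fun n hn => ?_
  refine le_trans (Nat.mul_le_mul_left 3 (card_le_card fun d hd => ?_)) (hN n hn.le)
  rw [mem_filter] at hd ⊢
  refine ⟨hd.1, fun hiff => hd.2 ?_⟩
  have hf := (mem_filter.1 hd.1).2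
  refine Iff.trans ?_ (encodingNatBool.mem_toLanguage_iff T d).symm
  simp only [iq3Set, Set.mem_setOf_eq]
  tauto

/-- **The `(1/6 + ε)`-form of the criterion = stub `stub_heurTransfer` of the picked line
`mirror-unit-signature`, verbatim** (its `MirrorAgreement T` unfolded): a set `T` agreeing with `IQ3` off a
`(1/6 + ε)`-fraction of every late block, for every `ε > 0`, with `bin T ∈ BPP`, refutes the crux — take
`ε = 1/6`, so `1/6 + 1/6 = 1/3 = δ`. The line applies it to the unit language `L_ε` (disagreement
`⊆ {#Cl₃(ℚ(√3d)) ≠ 1}`, mass `≤ 1/6 + o(1)` by Davenport–Heilbronn for real fields at the prime `3`): a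
classical `BPP` algorithm for the cube class of `ε_{ℚ(√3d)}` mod `9` kills the crux. [cite: BogdanovTrevisan2006, §2.3] -/
theorem not_avgFace_of_mirrorAgreement (T : Set ℕ)
    {inst : DecidablePred fun d : ℕ => ¬ (3 ∣ BinaryQuadraticForm.classNumber (-(d:ℤ)) ↔ d ∈ T)}
    (hMA : ∀ ε : ℝ, 0 < ε → ∀ᶠ n : ℕ in atTop,
      ((((fundBlock n).filter fun d : ℕ =>
          ¬ (3 ∣ BinaryQuadraticForm.classNumber (-(d:ℤ)) ↔ d ∈ T)).card : ℝ))
        ≤ (1 / 6 + ε) * ((fundBlock n).card : ℝ))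
    (hT : encodingNatBool.toLanguage T ∈ BPP) : ¬ AvgFaceBeyondPrior := by
  refine not_avgFace_of_eventually_agree hT (inst := inst) ?_
  filter_upwards [hMA (1 / 6) (by norm_num)] with n hn
  have h3 : (3:ℝ) * ((fundBlock n).filter fun d : ℕ =>
      ¬ (3 ∣ BinaryQuadraticForm.classNumber (-(d:ℤ)) ↔ d ∈ T)).card ≤ (fundBlock n).card := by
    linarith
  exact_mod_cast h3

end Summit.QuantumAdvantage.QuantumAdvantage.Theorems.AvgFaceBeyondPrior.Negative
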